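import Literature.NumberTheory.LFunctions.RodgersTaoZeroCountingProofs
import Literature.NumberTheory.LFunctions.RodgersTaoGapBoundProofs
import Literature.NumberTheory.LFunctions.RodgersTaoWeakEnergyAssemblyProofs
import HarnessLib

/-!
# Rodgers–Tao 2020, Corollary 3.3 (50) uniformly in `t`, and the as-printed (48), (50), Prop. 13, Prop. 15, Lemma 16 WITH CONTENT

Trunk T-ANT (`Literature/NumberTheory/LFunctions`). PROOFS ONLY: no definition, no named fact.
LINE 1 — LABEL: RH-FREE literature (Rodgers–Tao 2020, §§3–7); bears_on LADDER-RH N-C/N-P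
(COLUMN 3, DBN). WHAT THIS IS NOT: every statement here concerns `H_t` at times `t` lying above a
real-rooted time — vacuous for `ζ` at `t < 0` (the tree proves `Λ ≥ 0`, `rodgers_tao_holds`) and
the Riemann hypothesis' business at `t = 0`; proving the printed chain WITH CONTENT (instead of ex
falso from `Λ ≥ 0`) certifies the source's derivations, it does not move RH. Nothing in this file
bears on the truth of RH.

## What is proved

B. Rodgers, T. Tao, *The de Bruijn–Newman constant is non-negative*, Forum Math. Pi 8 (2020) e6,
Corollary 10 (= arXiv v4 Corollary 3.3), eq. (50), p. 23: «Let `Λ < t ⩽ 0`. Then one has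
`x_j(t) = ξ_j + O(log₊ ξ_j)` for all `j ∈ ℤ*`».

* `RodgersTao2020.cor33_location_of_count_estimate_uniform` — rt-t2's RH-free schema
  `cor33_location_of_count_estimate` ((48) at `t` ⟹ (50) at `t`, `RodgersTaoRiemannVonMangoldtProofs.lean`)
  with the constant quantified BEFORE `t`: `∀ A, ∃ B, ∀ t` above a real-rooted time,
  (48) with `A` ⟹ (50) with `B`. (The printed `Ψ`-inversion; t2's proof verbatim up to moving the
  existential — its `B = max(32πA⁺, (X₀ + ξ_{J₀})/log 2)` depends on `A` alone.)
* `RodgersTao2020.cor33_location_inner (T₀)` — `∃ B, ∀ t ∈ [−T₀, 0]` above a real-rooted time,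
  `∀ j ≥ 1, |x_j(t) − ξ_j| ≤ B log₊ ξ_j`: from `RodgersTao2020.thm32_bigO_inner` ((48),
  `RodgersTaoZeroCountingProofs.lean`). This is the `H2`/`h50` hypothesis of the §§5–7 schema
  theorems of the cell (`rodgers_tao_gap_bound_of`, `rodgers_tao_weak_energy_bound_of`, …) with ONE
  constant on the whole time interval.
* **The as-printed named facts WITH CONTENT.** By Newman's theorem (`Λ > −∞`:
  `bddBelow_setOf_hasOnlyRealZeros_holds`) every time above a real-rooted time lies in one window
  `[L, 0]`, so the uniform-on-`[−T₀,0]` theorems give the as-printed `sInf`-free statements with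
  ONE absolute constant: `RodgersTao2020.thm32_bigO_content : thm32_bigO` ((48)),
  `RodgersTao2020.cor33_location_content : cor33_location` ((50)), and — through the landed
  reductions `…_of_cor33_location` of rt-t2 / rt-t4 —
  `rodgers_tao_gap_bound_content : rodgers_tao_gap_bound` (Prop. 13 = v4 Prop. 5.1, (59)),
  `rodgers_tao_weak_energy_bound_content : rodgers_tao_weak_energy_bound` (Prop. 15 = v4 Prop. 6.1)
  (rt-t3's Lemma 16 = v4 Lemma 7.1 follows in one line, not re-declared here:
  `rodgers_tao_renormEnergyOn_expansion_of_cor33_location cor33_location_content`). Each of these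
  facts was so far discharged in the tree only EX FALSO (their `_holds`, from `Λ ≥ 0`); the present
  proofs follow the printed route (§2 asymptotics ⟹ (48) ⟹ (50) ⟹ §§5–7) and make no use of
  `Λ ≥ 0`. (Their hypothesis «`∃ t₀ < 0`, `H_{t₀}` real-rooted» remains, of course, unsatisfiable
  for `ζ`.)

Not treated: (49)/(52) (`thm32_littleO`, `cor33_gaps` — the normal-families step), (51)
(`cor33_order`: the printed absolute lower constant needs `inf_t x_1(t) > 0` on `(Λ, 0]`).

## References

* B. Rodgers, T. Tao, *The de Bruijn–Newman constant is non-negative*, Forum Math. Pi 8 (2020),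
  e6 = arXiv:1801.05914: Theorem 9 (48) p. 23, Corollary 10 (50) p. 23, Proposition 13 (59) p. 34,
  Proposition 15 p. 38 (Lemma 16 p. 41). [RodgersTaoFMP2020]
* C. M. Newman, *Fourier transforms with only real zeros*, Proc. AMS 61 (1976), Thm. 3 (`Λ > −∞`).
  [Newman1976]
-/

noncomputable section

open Complex Set Filter Topology
open scoped Real

namespace Literature.NumberTheory.LFunctions

namespace RodgersTao2020

/-- `log y ≤ 4·y^{1/4}` (`y > 0`), in the form `log y ≤ 4 √(√y)`. [folklore] -/
private theorem log_le_four_mul_sqrt_sqrt' {y : ℝ} (hy : 0 < y) :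
    Real.log y ≤ 4 * Real.sqrt (Real.sqrt y) := by
  have h1 : Real.log y = 4 * Real.log (Real.sqrt (Real.sqrt y)) := by
    rw [Real.log_sqrt (Real.sqrt_nonneg _), Real.log_sqrt hy.le]; ring
  have h2 : Real.log (Real.sqrt (Real.sqrt y)) ≤ Real.sqrt (Real.sqrt y) - 1 :=
    Real.log_le_sub_one_of_pos (Real.sqrt_pos.mpr (Real.sqrt_pos.mpr hy))
  linarith

/-- Growth of `log₊²`: `log₊² X ≤ 23 √X` for `X ≥ 2`. [folklore] -/
private theorem logPlus_sq_le_sqrt' {X : ℝ} (hX : 2 ≤ X) : logPlus X ^ 2 ≤ 23 * Real.sqrt X := by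
  have hX0 : 0 < X := by linarith
  have hs : logPlus X ≤ 4 * Real.sqrt (Real.sqrt (2 + X)) := by
    rw [logPlus_of_nonneg hX0.le]; exact log_le_four_mul_sqrt_sqrt' (by linarith)
  have hL0 : 0 ≤ logPlus X := (logPlus_pos X).le
  have h1 : logPlus X ^ 2 ≤ 16 * Real.sqrt (2 + X) := by
    calc logPlus X ^ 2 ≤ (4 * Real.sqrt (Real.sqrt (2 + X))) ^ 2 := pow_le_pow_left₀ hL0 hs 2
      _ = 16 * Real.sqrt (2 + X) := by rw [mul_pow, Real.sq_sqrt (Real.sqrt_nonneg _)]; norm_num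
  have h2 : Real.sqrt (2 + X) ≤ Real.sqrt 2 * Real.sqrt X := by
    rw [← Real.sqrt_mul (by norm_num : (0 : ℝ) ≤ 2)]
    exact Real.sqrt_le_sqrt (by linarith)
  have h3 : Real.sqrt 2 < 1.42 := by
    rw [Real.sqrt_lt' (by norm_num)]; norm_num
  nlinarith [Real.sqrt_nonneg X, Real.sqrt_nonneg 2]

/-- **Corollary 3.3, eq. (50), RH-FREE schema with the constant quantified BEFORE `t`**: for every
`A` there is `B` (namely `B = max(32π A⁺, (X₀ + ξ_{J₀})/log 2)`, `X₀ = (4π)⁴ + (96πA⁺ + 1)²`,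
`J₀ = X₀² + A⁺(2 + X₀)²`, `A⁺ = max A 0`) such that at every time `t` above a real-rooted time, the
count estimate (48) with constant `A` implies the location law (50) `|x_j(t) − ξ_j| ≤ B log₊ ξ_j`
for all `j ≥ 1`. The proof is rt-t2's `cor33_location_of_count_estimate`
(`RodgersTaoRiemannVonMangoldtProofs.lean`; the printed `Ψ`-inversion, FMP p.23 «Repeating the
previous analysis») with the existential moved in front of `t` — its `B` already depends on `A`
alone. [cite: RodgersTaoFMP2020, Corollary 3.3 = Corollary 10 eq. (50) p.23 (deduction from (48))] -/
theorem cor33_location_of_count_estimate_uniform (A : ℝ) :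
    ∃ B : ℝ, ∀ t : ℝ, (∃ t₁ : ℝ, t₁ < t ∧ HasOnlyRealZeros (deBruijnH t₁)) →
      (∀ T : ℝ, 0 < T →
        |(deBruijnZeroCount t (Icc 0 T) : ℝ) - rodgersTaoPsi T| ≤ A * logPlus T ^ 2) →
      ∀ j : ℕ, 1 ≤ j →
        |deBruijnZero t j - classicalLocation (j : ℝ)| ≤ B * logPlus (classicalLocation (j : ℝ)) := by
  have hπ0 : 0 < π := Real.pi_pos
  have hπ : 0 < 4 * π := by positivity
  have hπ3 := Real.pi_gt_three
  -- work with `A⁺ = max A 0` so that all thresholds are defined before `t`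
  set A' : ℝ := max A 0 with hA'
  have hA0 : 0 ≤ A' := le_max_right _ _
  have hAA' : A ≤ A' := le_max_left _ _
  -- thresholds
  obtain ⟨X₀, hX₀⟩ : ∃ X₀ : ℝ, X₀ = (4 * π) ^ 4 + (96 * π * A' + 1) ^ 2 := ⟨_, rfl⟩
  obtain ⟨J₀, hJ₀⟩ : ∃ J₀ : ℝ, J₀ = X₀ ^ 2 + A' * (2 + X₀) ^ 2 := ⟨_, rfl⟩
  have h4π2 : (2 : ℝ) ≤ 4 * π := by linarith
  have hpow4 : 2 * (4 * π) ≤ (4 * π) ^ 4 := by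
    have h3 : (2 : ℝ) ^ 3 ≤ (4 * π) ^ 3 := pow_le_pow_left₀ (by norm_num) h4π2 3
    calc 2 * (4 * π) ≤ 2 ^ 3 * (4 * π) := by linarith
      _ ≤ (4 * π) ^ 3 * (4 * π) := mul_le_mul_of_nonneg_right h3 hπ.le
      _ = (4 * π) ^ 4 := by ring
  have hsqA : 0 ≤ (96 * π * A' + 1) ^ 2 := sq_nonneg _
  have hX₀1 : (4 * π) ^ 4 ≤ X₀ := by rw [hX₀]; linarith
  have hX₀pos : 0 < X₀ := lt_of_lt_of_le (pow_pos hπ 4) hX₀1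
  have hX₀one : 1 ≤ X₀ := by linarith
  have hJ₀1 : 1 ≤ J₀ := by
    have h1 : 1 ≤ X₀ ^ 2 := one_le_pow₀ hX₀one
    have h2 : 0 ≤ A' * (2 + X₀) ^ 2 := mul_nonneg hA0 (sq_nonneg _)
    rw [hJ₀]; linarith
  have hlog2 : 0 < Real.log 2 := Real.log_pos one_lt_two
  have hlog2' : Real.log 2 < 1 := by have := Real.log_two_lt_d9; linarith
  have hξJ₀ : 0 < classicalLocation J₀ := classicalLocation_pos (by linarith)
  set B : ℝ := max (32 * π * A') ((X₀ + classicalLocation J₀) / Real.log 2) with hB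
  have hmaxB : 32 * π * A' ≤ B := le_max_left _ _
  have hmaxB' : (X₀ + classicalLocation J₀) / Real.log 2 ≤ B := le_max_right _ _
  have hB0 : 0 ≤ B := le_trans (by positivity) hmaxB
  refine ⟨B, fun t hΛ h48A j hj ↦ ?_⟩
  -- (48) with `A⁺` in place of `A`
  have h48 : ∀ T : ℝ, 0 < T →
      |(deBruijnZeroCount t (Icc 0 T) : ℝ) - rodgersTaoPsi T| ≤ A' * logPlus T ^ 2 := fun T hT ↦
    (h48A T hT).trans (mul_le_mul_of_nonneg_right hAA' (sq_nonneg _))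
  have hj1 : (1 : ℝ) ≤ j := by exact_mod_cast hj
  -- the two inputs about `x_j(t)`: it is positive and `N_t([0, x_j(t)]) = j`
  have hX0 : 0 < deBruijnZero t j := deBruijnZero_pos hΛ hj
  have h48X : |(j : ℝ) - rodgersTaoPsi (deBruijnZero t j)| ≤
      A' * logPlus (deBruijnZero t j) ^ 2 := by
    have h := h48 _ hX0
    rwa [deBruijnZeroCount_Icc_deBruijnZero hΛ j] at h
  -- the inputs about `ξ_j`
  have hΨξ : rodgersTaoPsi (classicalLocation (j : ℝ)) = j :=
    rodgersTaoPsi_classicalLocation (by linarith)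
  have hξ4 : 4 * π ≤ classicalLocation (j : ℝ) := four_pi_le_classicalLocation (by linarith)
  have hξimp : (j : ℝ) ≤ J₀ → classicalLocation (j : ℝ) ≤ classicalLocation J₀ := fun h ↦
    (classicalLocation_le_iff (by linarith) (by linarith)).2 h
  generalize hXdef : deBruijnZero t j = X at hX0 h48X ⊢
  generalize hξdef : classicalLocation (j : ℝ) = ξ at hΨξ hξ4 hξimp ⊢
  clear hXdef hξdef h48 h48A hΛ
  set L := logPlus X with hL
  have hξ0 : 0 < ξ := hπ.trans_le hξ4
  have hLξ2 : Real.log 2 ≤ logPlus ξ := log_two_le_logPlus ξ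
  have hLξ0 : 0 < logPlus ξ := logPlus_pos ξ
  have hL0 : 0 < L := logPlus_pos X
  have hdiff : |rodgersTaoPsi ξ - rodgersTaoPsi X| ≤ A' * L ^ 2 := by rw [hΨξ]; exact h48X
  rcases lt_or_ge X X₀ with hsmall | hlarge
  · -- small zeros: j ≤ J₀, so everything is bounded
    have hjle : (j : ℝ) ≤ J₀ := by
      have h1 : (j : ℝ) ≤ rodgersTaoPsi X + A' * L ^ 2 := by
        have := (abs_sub_le_iff.1 h48X).1; linarith
      have hΨle : rodgersTaoPsi X ≤ X₀ ^ 2 := by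
        rw [rodgersTaoPsi_eq_mul]
        have hy : 0 < X / (4 * π) := div_pos hX0 hπ
        have hlog : Real.log (X / (4 * π)) - 1 ≤ X / (4 * π) := by
          have := Real.log_le_sub_one_of_pos hy; linarith
        have hy1 : X / (4 * π) ≤ X := div_le_self hX0.le (by linarith)
        calc X / (4 * π) * (Real.log (X / (4 * π)) - 1) ≤ X / (4 * π) * (X / (4 * π)) :=
              mul_le_mul_of_nonneg_left hlog hy.le
          _ ≤ X * X := mul_le_mul hy1 hy1 hy.le hX0.le
          _ ≤ X₀ * X₀ := mul_le_mul hsmall.le hsmall.le hX0.le hX₀pos.le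
          _ = X₀ ^ 2 := by ring
      have hLle : L ≤ 2 + X₀ := by
        rw [hL, logPlus_of_nonneg hX0.le]
        have := Real.log_le_sub_one_of_pos (show 0 < 2 + X by linarith); linarith
      have hL2 : L ^ 2 ≤ (2 + X₀) ^ 2 := pow_le_pow_left₀ hL0.le hLle 2
      have hAL : A' * L ^ 2 ≤ A' * (2 + X₀) ^ 2 := mul_le_mul_of_nonneg_left hL2 hA0
      rw [hJ₀]; linarith
    have hξle : ξ ≤ classicalLocation J₀ := hξimp hjle
    have hbound : |X - ξ| ≤ X₀ + classicalLocation J₀ := by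
      rw [abs_le]; constructor <;> linarith
    have hq : 0 ≤ (X₀ + classicalLocation J₀) / Real.log 2 := by positivity
    calc |X - ξ| ≤ X₀ + classicalLocation J₀ := hbound
      _ = (X₀ + classicalLocation J₀) / Real.log 2 * Real.log 2 := by field_simp
      _ ≤ (X₀ + classicalLocation J₀) / Real.log 2 * logPlus ξ :=
          mul_le_mul_of_nonneg_left hLξ2 hq
      _ ≤ B * logPlus ξ := mul_le_mul_of_nonneg_right hmaxB' hLξ0.le
  · -- large zeros: Ψ-inversion by the mean value theorem
    have hX4 : (4 * π) ^ 4 ≤ X := hX₀1.trans hlarge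
    have hX8π : 2 * (4 * π) ≤ X := hpow4.trans hX4
    have hX2 : 2 ≤ X := by linarith
    have hX4π : 4 * π ≤ X := by linarith
    have hXhalf4π : 4 * π ≤ X / 2 := by linarith
    have hl4π := two_lt_log_four_pi
    have hl4π3 := log_four_pi_lt_three
    have hlogX : Real.log ((4 * π) ^ 4) ≤ Real.log X := Real.log_le_log (pow_pos hπ 4) hX4
    have hlogX8 : 8 < Real.log X := by rw [Real.log_pow] at hlogX; push_cast at hlogX; linarith
    have hlog8π : Real.log (8 * π) < 4 := by
      rw [show (8 : ℝ) * π = 2 * (4 * π) by ring, Real.log_mul (by norm_num) hπ.ne']; linarith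
    have h8π : 0 < 8 * π := by positivity
    have hlogX8π : Real.log (X / (8 * π)) = Real.log X - Real.log (8 * π) :=
      Real.log_div hX0.ne' h8π.ne'
    have hkey2 : 2 ≤ Real.log (X / (8 * π)) := by linarith
    have hLle : L ≤ 2 * Real.log X := by
      rw [hL, logPlus_of_nonneg hX0.le]
      have h1 : Real.log (2 + X) ≤ Real.log (2 * X) := Real.log_le_log (by linarith) (by linarith)
      rw [Real.log_mul (by norm_num) hX0.ne'] at h1
      linarith
    have hkeyL : L / 4 ≤ Real.log (X / (8 * π)) := by linarith
    have hX8π0 : 0 < X / (8 * π) := div_pos hX0 h8π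
    rcases le_or_gt ξ X with hξX | hXξ
    · -- ξ_j ≤ x_j: first ξ_j ≥ x_j / 2
      have hξhalf : X / 2 ≤ ξ := by
        by_contra hcon
        have hlt : ξ < X / 2 := lt_of_not_ge hcon
        have hmvt := rodgersTaoPsi_sub_ge hXhalf4π (show X / 2 ≤ X by linarith)
        rw [show X / 2 / (4 * π) = X / (8 * π) by ring, show X - X / 2 = X / 2 by ring] at hmvt
        have hX20 : 0 ≤ X / 2 := by linarith
        have hmono := strictMonoOn_rodgersTaoPsi.monotoneOn (show ξ ∈ Ici (4 * π) from hξ4)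
          (show X / 2 ∈ Ici (4 * π) from hXhalf4π) hlt.le
        have hlow : X / (4 * π) ≤ rodgersTaoPsi X - rodgersTaoPsi (X / 2) := by
          calc X / (4 * π) = X / 2 * (2 / (4 * π)) := by ring
            _ ≤ X / 2 * (Real.log (X / (8 * π)) / (4 * π)) :=
                mul_le_mul_of_nonneg_left (div_le_div_of_nonneg_right hkey2 hπ.le) hX20
            _ ≤ _ := hmvt
        have hup : rodgersTaoPsi X - rodgersTaoPsi (X / 2) ≤ A' * L ^ 2 := by
          have := (abs_sub_le_iff.1 hdiff).2; linarith
        have hgrowth : L ^ 2 ≤ 23 * Real.sqrt X := logPlus_sq_le_sqrt' hX2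
        have hsX0 : 0 < Real.sqrt X := Real.sqrt_pos.2 hX0
        have hss : Real.sqrt X * Real.sqrt X = X := Real.mul_self_sqrt hX0.le
        have hAg : A' * L ^ 2 ≤ A' * (23 * Real.sqrt X) := mul_le_mul_of_nonneg_left hgrowth hA0
        have h1 : X / (4 * π) ≤ 23 * A' * Real.sqrt X := by linarith
        have h2 : Real.sqrt X ≤ 92 * π * A' := by
          rw [div_le_iff₀ hπ] at h1
          have h1' : Real.sqrt X * Real.sqrt X ≤ 92 * π * A' * Real.sqrt X := by
            rw [hss]; linarith
          exact le_of_mul_le_mul_right h1' hsX0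
        have h92 : 0 ≤ 92 * π * A' := by positivity
        have h3 : X ≤ (92 * π * A') ^ 2 := by
          calc X = Real.sqrt X * Real.sqrt X := hss.symm
            _ ≤ (92 * π * A') * (92 * π * A') := mul_le_mul h2 h2 hsX0.le h92
            _ = (92 * π * A') ^ 2 := by ring
        have h4 : (92 * π * A') ^ 2 < X₀ := by
          have hπA : 0 ≤ π * A' := mul_nonneg hπ0.le hA0
          have hfac : (96 * π * A' + 1) ^ 2 - (92 * π * A') ^ 2 =
              (4 * π * A' + 1) * (188 * π * A' + 1) := by ring
          have hprod : 1 ≤ (4 * π * A' + 1) * (188 * π * A' + 1) :=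
            one_le_mul_of_one_le_of_one_le (by linarith) (by linarith)
          have := pow_pos hπ 4
          rw [hX₀]; linarith
        linarith
      have hmvt := rodgersTaoPsi_sub_ge hξ4 hξX
      have hlogξ : L / 4 ≤ Real.log (ξ / (4 * π)) := by
        have hle : X / (8 * π) ≤ ξ / (4 * π) := by
          rw [div_le_div_iff₀ h8π hπ]
          calc X * (4 * π) ≤ 2 * ξ * (4 * π) :=
                mul_le_mul_of_nonneg_right (by linarith) hπ.le
            _ = ξ * (8 * π) := by ring
        have : Real.log (X / (8 * π)) ≤ Real.log (ξ / (4 * π)) := Real.log_le_log hX8π0 hle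
        linarith
      have hup : rodgersTaoPsi X - rodgersTaoPsi ξ ≤ A' * L ^ 2 := (abs_sub_le_iff.1 hdiff).2
      have hXξ0 : 0 ≤ X - ξ := by linarith
      have h1 : (X - ξ) * (L / 4 / (4 * π)) ≤ A' * L ^ 2 := by
        calc (X - ξ) * (L / 4 / (4 * π)) ≤ (X - ξ) * (Real.log (ξ / (4 * π)) / (4 * π)) :=
              mul_le_mul_of_nonneg_left (div_le_div_of_nonneg_right hlogξ hπ.le) hXξ0
          _ ≤ A' * L ^ 2 := hmvt.trans hup
      have h2 : X - ξ ≤ 16 * π * A' * L := by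
        have h1' : (X - ξ) * L ≤ 16 * π * A' * L * L := by
          have h16 : (0 : ℝ) ≤ 16 * π := by positivity
          have hm := mul_le_mul_of_nonneg_right h1 h16
          have e1 : (X - ξ) * (L / 4 / (4 * π)) * (16 * π) = (X - ξ) * L := by
            field_simp; ring
          have e2 : A' * L ^ 2 * (16 * π) = 16 * π * A' * L * L := by ring
          rwa [e1, e2] at hm
        exact le_of_mul_le_mul_right h1' hL0
      have hLξ : L ≤ 2 * logPlus ξ := by
        rw [hL, logPlus_of_nonneg hX0.le, logPlus_of_nonneg hξ0.le]
        have h1 : Real.log (2 + X) ≤ Real.log (2 * (2 + ξ)) :=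
          Real.log_le_log (by linarith) (by linarith)
        rw [Real.log_mul (by norm_num) (by linarith)] at h1
        have h2 : Real.log 4 ≤ Real.log (2 + X) := Real.log_le_log (by norm_num) (by linarith)
        have h4 : Real.log 4 = 2 * Real.log 2 := by
          rw [show (4 : ℝ) = 2 ^ 2 by norm_num, Real.log_pow]; ring
        linarith
      rw [abs_of_nonneg hXξ0]
      have hπA : 0 ≤ 16 * π * A' := by positivity
      calc X - ξ ≤ 16 * π * A' * L := h2
        _ ≤ 16 * π * A' * (2 * logPlus ξ) := mul_le_mul_of_nonneg_left hLξ hπA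
        _ = 32 * π * A' * logPlus ξ := by ring
        _ ≤ B * logPlus ξ := mul_le_mul_of_nonneg_right hmaxB hLξ0.le
    · -- x_j < ξ_j
      have hmvt := rodgersTaoPsi_sub_ge hX4π hXξ.le
      have hlogX' : L / 4 ≤ Real.log (X / (4 * π)) := by
        have hle : X / (8 * π) ≤ X / (4 * π) :=
          div_le_div_of_nonneg_left hX0.le hπ (by linarith)
        have : Real.log (X / (8 * π)) ≤ Real.log (X / (4 * π)) := Real.log_le_log hX8π0 hle
        linarith
      have hup : rodgersTaoPsi ξ - rodgersTaoPsi X ≤ A' * L ^ 2 := (abs_sub_le_iff.1 hdiff).1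
      have hξX0 : 0 ≤ ξ - X := by linarith
      have h1 : (ξ - X) * (L / 4 / (4 * π)) ≤ A' * L ^ 2 := by
        calc (ξ - X) * (L / 4 / (4 * π)) ≤ (ξ - X) * (Real.log (X / (4 * π)) / (4 * π)) :=
              mul_le_mul_of_nonneg_left (div_le_div_of_nonneg_right hlogX' hπ.le) hξX0
          _ ≤ A' * L ^ 2 := hmvt.trans hup
      have h2 : ξ - X ≤ 16 * π * A' * L := by
        have h1' : (ξ - X) * L ≤ 16 * π * A' * L * L := by
          have h16 : (0 : ℝ) ≤ 16 * π := by positivity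
          have hm := mul_le_mul_of_nonneg_right h1 h16
          have e1 : (ξ - X) * (L / 4 / (4 * π)) * (16 * π) = (ξ - X) * L := by
            field_simp; ring
          have e2 : A' * L ^ 2 * (16 * π) = 16 * π * A' * L * L := by ring
          rwa [e1, e2] at hm
        exact le_of_mul_le_mul_right h1' hL0
      have hLξ : L ≤ logPlus ξ :=
        logPlus_le_logPlus (by rw [abs_of_pos hX0, abs_of_pos hξ0]; exact hXξ.le)
      rw [abs_sub_comm, abs_of_nonneg hξX0]
      have hπA : 0 ≤ 16 * π * A' := by positivity
      have hAL : 0 ≤ 16 * π * A' * logPlus ξ := mul_nonneg hπA hLξ0.le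
      calc ξ - X ≤ 16 * π * A' * L := h2
        _ ≤ 16 * π * A' * logPlus ξ := mul_le_mul_of_nonneg_left hLξ hπA
        _ ≤ 32 * π * A' * logPlus ξ := by linarith
        _ ≤ B * logPlus ξ := mul_le_mul_of_nonneg_right hmaxB hLξ0.le

/-- **Corollary 3.3, eq. (50) — RH-FREE, over the kernel theorems, uniformly on `[−T₀, 0]`.**
For every `T₀` there is `B` such that for every `t ∈ [−T₀, 0]` above a real-rooted time and every
`j ≥ 1`, `|x_j(t) − ξ_j| ≤ B log₊ ξ_j`. This is rt-t2's `H2`/`h50` hypothesis shape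
(`rodgers_tao_gap_bound_of`, `rodgers_tao_weak_energy_bound_of`, …) with ONE constant on the whole
interval: `thm32_bigO_inner` ((48), `RodgersTaoZeroCountingProofs.lean`) fed into
`cor33_location_of_count_estimate_uniform`. [cite: RodgersTaoFMP2020, Corollary 3.3 = Corollary 10 eq. (50) p.23] -/
theorem cor33_location_inner (T₀ : ℝ) :
    ∃ B : ℝ, ∀ t ∈ Icc (-T₀) 0, (∃ t₁ : ℝ, t₁ < t ∧ HasOnlyRealZeros (deBruijnH t₁)) →
      ∀ j : ℕ, 1 ≤ j →
        |deBruijnZero t j - classicalLocation (j : ℝ)| ≤ B * logPlus (classicalLocation (j : ℝ)) := by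
  obtain ⟨A, hA⟩ := thm32_bigO_inner T₀
  obtain ⟨B, hB⟩ := cor33_location_of_count_estimate_uniform A
  exact ⟨B, fun t ht hΛ j hj ↦ hB t hΛ (hA t ht hΛ) j hj⟩

/-- **Theorem 3.2 (48) AS PRINTED, WITH CONTENT.** The as-printed named fact `thm32_bigO`
(range «`Λ < t ≤ 0`», `sInf`-free: `∃ t₁ < t` real-rooted and `t ≤ 0`, ONE absolute constant) —
so far in the tree only EX FALSO (`thm32_bigO_holds`, from `Λ ≥ 0`) — proved here along the
printed route: the set of real-rooted times is bounded below (Newman 1976,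
`bddBelow_setOf_hasOnlyRealZeros_holds`), so every admissible `t` lies in one compact window
`[L, 0]`, on which `thm32_bigO_inner` gives a uniform constant. No use of `Λ ≥ 0`.
[cite: RodgersTaoFMP2020, Theorem 3.2 (48) = Theorem 9 (48) p.23] -/
theorem thm32_bigO_content : thm32_bigO := by
  obtain ⟨L, hL⟩ := bddBelow_setOf_hasOnlyRealZeros_holds
  obtain ⟨A, hA⟩ := thm32_bigO_inner (-L)
  refine ⟨A, fun t hΛ ht0 T hT ↦ hA t ⟨?_, ht0⟩ hΛ T hT⟩
  obtain ⟨t₁, ht₁, hr⟩ := hΛ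
  have := hL hr
  linarith

/-- **Corollary 3.3 (50) AS PRINTED, WITH CONTENT.** The as-printed named fact `cor33_location`
(`∃ A, ∀ t` above a real-rooted time with `t ≤ 0`, `∀ j ≥ 1, |x_j(t) − ξ_j| ≤ A log₊ ξ_j`) — so
far only EX FALSO in the tree (`cor33_location_holds`) — proved along the printed route:
Newman's lower bound for the real-rooted times + `cor33_location_inner`. No use of `Λ ≥ 0`.
[cite: RodgersTaoFMP2020, Corollary 3.3 = Corollary 10 eq. (50) p.23] -/
theorem cor33_location_content : cor33_location := by
  obtain ⟨L, hL⟩ := bddBelow_setOf_hasOnlyRealZeros_holds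
  obtain ⟨B, hB⟩ := cor33_location_inner (-L)
  refine ⟨B, fun t hΛ ht0 j hj ↦ hB t ⟨?_, ht0⟩ hΛ j hj⟩
  obtain ⟨t₁, ht₁, hr⟩ := hΛ
  have := hL hr
  linarith

end RodgersTao2020

/-! ## The §§5–7 facts AS PRINTED, WITH CONTENT (composition with the landed reductions) -/

/-- **Rodgers–Tao 2020 Proposition 13 (= v4 Prop. 5.1, the lower bound on gaps (59)) AS PRINTED,
WITH CONTENT**: the named fact `rodgers_tao_gap_bound` — in the tree so far EX FALSO
(`rodgers_tao_gap_bound_holds`) next to rt-t2's RH-free schema `rodgers_tao_gap_bound_of` and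
reduction `rodgers_tao_gap_bound_of_cor33_location` (`RodgersTaoGapBoundProofs.lean`) — now
follows with content: `cor33_location_content` fed into that reduction. No use of `Λ ≥ 0`.
[cite: RodgersTaoFMP2020, Proposition 13 (= arXiv v4 Prop. 5.1) eq. (59) p.34] -/
theorem rodgers_tao_gap_bound_content : rodgers_tao_gap_bound :=
  rodgers_tao_gap_bound_of_cor33_location RodgersTao2020.cor33_location_content

/-- **Rodgers–Tao 2020 Proposition 15 (= v4 Prop. 6.1, weak bound on the integrated energy) AS
PRINTED, WITH CONTENT**: the named fact `rodgers_tao_weak_energy_bound` — so far EX FALSO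
(`rodgers_tao_weak_energy_bound_holds`) next to rt-t4's RH-free schema
`rodgers_tao_weak_energy_bound_of` and reduction `rodgers_tao_weak_energy_bound_of_cor33_location`
(`RodgersTaoWeakEnergyAssemblyProofs.lean`) — now follows with content from
`cor33_location_content`. No use of `Λ ≥ 0`. [cite: RodgersTaoFMP2020, Proposition 15 (= arXiv v4 Prop. 6.1) p.38] -/
theorem rodgers_tao_weak_energy_bound_content : rodgers_tao_weak_energy_bound :=
  rodgers_tao_weak_energy_bound_of_cor33_location RodgersTao2020.cor33_location_content

/- Lemma 16 (= v4 Lemma 7.1) as printed, `rodgers_tao_renormEnergyOn_expansion`, follows in the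
same way in one line — `rodgers_tao_renormEnergyOn_expansion_of_cor33_location
RodgersTao2020.cor33_location_content` — but its type coincides with the landed
`rodgers_tao_renormEnergyOn_expansion_holds`, so it is not re-declared here (dedup rule). -/


end Literature.NumberTheory.LFunctions
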